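import Literature.Probability.Percolation.TriPolyhexDisc
import HarnessLib

/-!
# From hole-free polyhexes to discrete domains

Topic `Literature/Probability/Percolation`; family `crit-perc`. Constructors of the tree's
discrete domains `TriMarkedDomain` (`TriDiscreteDomain.lean`) from the topological description
of Bollobás–Riordan (*Percolation* (2006), Ch. 7 §7.2.2, pp. 168–169), on top of
`TriPolyhexDisc.lean` (hole-free polyhexes are discs) — the interface through which the
discrete approximations of a Jordan domain (Lemma 14, p. 184) are to be built:

* `TriMarkedDomain.ofPolyhex` — a finite nonempty set of sites, connected, with connected
  complement, such that neither it nor its outer boundary has a cut vertex, is an unmarked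
  (`0`-marked) discrete domain;
* `TriMarkedDomain.withMarks` — marking a discrete domain at boundary positions
  `q 0 < ⋯ < q (k-1) < q 0 + #∂` each pointing to the second outside neighbour of its tail,
  with distinct tails (rebased at the first); `withMarks_markDart`;
* `IsTriDisc.outer_connected` — the outer boundary of a disc is connected (consecutive heads
  of the boundary cycle are equal or adjacent, `snd_triBdrySucc_eq_or_adj`);
* `pathIn_erase_of_thickening` — **the one-layer thickening of a connected set has no cut
  vertex** (everything hangs on the set; the two sides of a removed site are joined around its
  ring of neighbours, `pathIn_ring`);
* `preconnected_induce_of_pathIn`, `connected_induce_of_pathIn` — from paths inside a set to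
  connectivity of the induced subgraph (converse of `pathIn_of_preconnected_induce`).

## References

* B. Bollobás, O. Riordan, *Percolation*, Cambridge University Press (2006), Ch. 7 §7.2.2
  pp. 168–169.

## Mathlib / tree

Tree: `TriPolyhexDisc.lean` (`exists_isTriDisc_of_coconnected`), `TriDiscShelling.lean`
(`IsTriDisc`, `rebase`), `TriDiscreteDomain.lean` (`TriMarkedDomain`, `triBdrySucc`,
`triGraph_adj_triLeftApex_right`), `SitePaths.lean` (`PathIn`).
-/

noncomputable section

open Finset Literature.Probability.LatticeModels

namespace Literature.Probability.Percolation

/-- Paths inside a set give connectivity of the induced subgraph. [folklore] -/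
theorem preconnected_induce_of_pathIn {S : Set (Site 2)} (h : ∀ x ∈ S, ∀ y ∈ S, PathIn triGraph S x y) :
    (triGraph.induce S).Preconnected := by
  rintro ⟨x, hx⟩ ⟨y, hy⟩
  obtain ⟨-, hR⟩ := h x hx y hy
  revert hy
  induction hR with
  | refl => intro _; exact SimpleGraph.Reachable.refl _
  | @tail b c hxb hbc ih =>
    intro hc
    have hb : b ∈ S := PathIn.right_mem (G := triGraph) (show PathIn triGraph S x b from ⟨hx, hxb⟩)
    exact (ih hb).trans (SimpleGraph.Adj.reachable
      (show (triGraph.induce S).Adj ⟨b, hb⟩ ⟨c, hc⟩ from SimpleGraph.induce_adj.2 hbc.1))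

/-- Paths inside a nonempty set give connectedness of the induced subgraph. [folklore] -/
theorem connected_induce_of_pathIn {S : Set (Site 2)} (hne : S.Nonempty) (h : ∀ x ∈ S, ∀ y ∈ S, PathIn triGraph S x y) :
    (triGraph.induce S).Connected :=
  { preconnected := preconnected_induce_of_pathIn h
    nonempty := ⟨⟨hne.some, hne.some_mem⟩⟩ }

/-- **Heads of consecutive boundary darts are equal or adjacent** (the traversal either keeps the
head and turns the tail, or moves the head to the apex, a common neighbour). [folklore] -/
theorem snd_triBdrySucc_eq_or_adj (G : Finset (Site 2)) {d : Site 2 × Site 2} (hd : triGraph.Adj d.1 d.2) :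
    (triBdrySucc G d).2 = d.2 ∨ triGraph.Adj d.2 (triBdrySucc G d).2 := by
  unfold triBdrySucc
  split_ifs with h
  · exact Or.inl rfl
  · exact Or.inr (triGraph_adj_triLeftApex_right hd).symm

/-- **The outer boundary of a disc is connected**: every outer site is the head of a boundary
dart, all darts lie on the one boundary cycle, and consecutive heads are equal or adjacent. [folklore] -/
theorem IsTriDisc.outer_connected {G : Finset (Site 2)} {b : Site 2 × Site 2} (h : IsTriDisc G b) :
    (triGraph.induce (↑(triOuterBdry G) : Set (Site 2))).Connected := by
  have hb := h.base_mem
  -- the heads along the cycle, from the base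
  have hhead : ∀ n, (triBdryIter G b n).2 ∈ (↑(triOuterBdry G) : Set (Site 2)) := fun n =>
    mem_coe.2 (mem_image_of_mem _ (triBdryIter_mem hb n))
  have hpath : ∀ n, PathIn triGraph (↑(triOuterBdry G) : Set (Site 2)) b.2 (triBdryIter G b n).2 := by
    intro n
    induction n with
    | zero => exact PathIn.refl (hhead 0)
    | succ n ih =>
      rw [triBdryIter_succ]
      rcases snd_triBdrySucc_eq_or_adj G (mem_triBdryDarts.1 (triBdryIter_mem hb n)).2.2 with e | hadj
      · rw [e]; exact ih
      · exact ih.tail hadj (by rw [← triBdryIter_succ]; exact hhead (n + 1))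
  refine connected_induce_of_pathIn ⟨b.2, hhead 0⟩ fun x hx y hy => ?_
  obtain ⟨d, hd, rfl⟩ := mem_image.1 (mem_coe.1 hx)
  obtain ⟨d', hd', rfl⟩ := mem_image.1 (mem_coe.1 hy)
  obtain ⟨n, -, rfl⟩ := h.cycle d hd
  obtain ⟨n', -, rfl⟩ := h.cycle d' hd'
  exact (hpath n).symm.trans (hpath n')

/-! ### Thickening by one layer removes cut vertices -/

/-- Consecutive ring sites around `v` are joined along the ring inside any set containing the
ring. [folklore] -/
theorem pathIn_ring {A : Set (Site 2)} {v : Site 2} (hA : ∀ j : Fin 6, v + triDir j ∈ A) (j : Fin 6) :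
    ∀ n : ℕ, PathIn triGraph A (v + triDir j) (v + triDir (j + Fin.ofNat 6 n)) := by
  intro n
  induction n with
  | zero => simpa using PathIn.refl (hA j)
  | succ n ih =>
    have e : j + Fin.ofNat 6 (n + 1) = j + Fin.ofNat 6 n + 1 := by
      rw [add_assoc]; congr 1
      apply Fin.ext; rw [Fin.val_add, Fin.val_ofNat, Fin.val_ofNat]; simp [Nat.add_mod]
    rw [e]
    exact ih.tail (triGraph_adj_consec v _) (hA _)

/-- Any two ring sites around `v` are joined along the ring. [folklore] -/
theorem pathIn_ring' {A : Set (Site 2)} {v : Site 2} (hA : ∀ j : Fin 6, v + triDir j ∈ A) (j k : Fin 6) :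
    PathIn triGraph A (v + triDir j) (v + triDir k) := by
  obtain ⟨t, rfl⟩ := RemovableAt.exists_offset j k
  have := pathIn_ring hA j t.val
  have e : Fin.ofNat 6 t.val = t := Fin.ext (by rw [Fin.val_ofNat, Nat.mod_eq_of_lt t.isLt])
  rwa [e] at this

/-- **The one-layer thickening of a connected set has no cut vertex.** If `G` consists of the
sites of a connected nonempty set `F` together with all their neighbours, then removing any
single site from `G` leaves it connected: everything hangs on `F`, and the two sides of a
removed site of `F` are joined around its ring of neighbours, which lies in `G`. [folklore] -/
theorem pathIn_erase_of_thickening {F G : Finset (Site 2)} (hF : ∀ p ∈ F, ∀ q ∈ F, PathIn triGraph (↑F : Set (Site 2)) p q)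
    (hG : ∀ x, x ∈ G ↔ x ∈ F ∨ ∃ f ∈ F, triGraph.Adj f x) (v : Site 2) :
    ∀ p ∈ G.erase v, ∀ q ∈ G.erase v, PathIn triGraph (↑(G.erase v) : Set (Site 2)) p q := by
  have hFG : ∀ f ∈ F, f ∈ G := fun f hf => (hG f).2 (Or.inl hf)
  have hNG : ∀ f ∈ F, ∀ j : Fin 6, f + triDir j ∈ G := fun f hf j => (hG _).2 (Or.inr ⟨f, hf, triGraph_adj_add_triDir f j⟩)
  by_cases hv : v ∈ F
  · -- anchor: the ring around `v`
    have hring : ∀ j : Fin 6, v + triDir j ∈ (↑(G.erase v) : Set (Site 2)) := fun j =>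
      mem_coe.2 (mem_erase.2 ⟨add_triDir_ne v j, hNG v hv j⟩)
    have key : ∀ p ∈ G.erase v, PathIn triGraph (↑(G.erase v) : Set (Site 2)) p (v + triDir 0) := by
      intro p hp
      obtain ⟨hpv, hpG⟩ := mem_erase.1 hp
      -- reduce to a site of `F ∖ {v}` or a ring site
      have fromF : ∀ p ∈ F, p ≠ v → PathIn triGraph (↑(G.erase v) : Set (Site 2)) p (v + triDir 0) := by
        intro p hpF hpv
        obtain ⟨a, b, ha, hb, -, hab, hpa⟩ := (hF p hpF v hv).exit (R := {x | x ≠ v}) hpv (fun h => h rfl)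
        have hbv : b = v := by by_contra h; exact hb h
        subst hbv
        obtain ⟨j, rfl⟩ := (triGraph_adj_iff_triDir b a).1 hab.symm
        refine (hpa.mono fun x hx => ?_).trans (pathIn_ring' hring j 0)
        exact mem_coe.2 (mem_erase.2 ⟨hx.1, hFG x (mem_coe.1 hx.2)⟩)
      rcases (hG p).1 hpG with hpF | ⟨f, hfF, hfp⟩
      · exact fromF p hpF hpv
      · by_cases hfv : f = v
        · subst hfv
          obtain ⟨j, rfl⟩ := (triGraph_adj_iff_triDir f p).1 hfp
          exact pathIn_ring' hring j 0
        · exact (PathIn.of_adj (mem_coe.2 hp) (mem_coe.2 (mem_erase.2 ⟨hfv, hFG f hfF⟩)) hfp.symm).trans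
            (fromF f hfF hfv)
    intro p hp q hq
    exact (key p hp).trans (key q hq).symm
  · -- `v ∉ F`: everything hangs on `F ⊆ G ∖ {v}`
    have hFsub : (↑F : Set (Site 2)) ⊆ (↑(G.erase v) : Set (Site 2)) := fun f hf =>
      mem_coe.2 (mem_erase.2 ⟨fun e => hv (e ▸ mem_coe.1 hf), hFG f (mem_coe.1 hf)⟩)
    have key : ∀ p ∈ G.erase v, ∃ f ∈ F, PathIn triGraph (↑(G.erase v) : Set (Site 2)) p f := by
      intro p hp
      obtain ⟨hpv, hpG⟩ := mem_erase.1 hp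
      rcases (hG p).1 hpG with hpF | ⟨f, hfF, hfp⟩
      · exact ⟨p, hpF, PathIn.refl (mem_coe.2 hp)⟩
      · exact ⟨f, hfF, PathIn.of_adj (mem_coe.2 hp) (hFsub (mem_coe.2 hfF)) hfp.symm⟩
    intro p hp q hq
    obtain ⟨f, hf, hpf⟩ := key p hp
    obtain ⟨f', hf', hqf'⟩ := key q hq
    exact (hpf.trans ((hF f hf f' hf').mono hFsub)).trans hqf'.symm

/-! ### Constructors of discrete domains -/

/-- **An unmarked discrete domain from a hole-free polyhex**: a finite nonempty set of sites,
connected, with connected complement, and such that neither it nor its outer boundary has a cut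
vertex, is a `0`-marked discrete domain (Bollobás–Riordan 2006, Ch. 7 §7.2.2 p. 168: the
union of hexagons simply connected, "neither `G` nor `∂⁺(G)` has a cut-vertex"), based at a
boundary dart given by `exists_isTriDisc_of_coconnected`. [cite: BollobasRiordan2006, Ch. 7 §7.2.2 p. 168] -/
def TriMarkedDomain.ofPolyhex (S : Finset (Site 2)) (hne : S.Nonempty)
    (hconn : ∀ p ∈ S, ∀ q ∈ S, PathIn triGraph (↑S : Set (Site 2)) p q)
    (hco : ∀ o ∉ S, ∀ o' ∉ S, PathIn triGraph ((↑S : Set (Site 2))ᶜ) o o')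
    (hnc : ∀ v ∈ S, ∀ p ∈ S.erase v, ∀ q ∈ S.erase v, PathIn triGraph (↑(S.erase v) : Set (Site 2)) p q)
    (honc : ∀ v ∈ triOuterBdry S, ∀ p ∈ (triOuterBdry S).erase v, ∀ q ∈ (triOuterBdry S).erase v,
      PathIn triGraph (↑((triOuterBdry S).erase v) : Set (Site 2)) p q) : TriMarkedDomain 0 :=
  have hD : IsTriDisc S (Classical.choose (exists_isTriDisc_of_coconnected _ S rfl hne hconn hco)) :=
    Classical.choose_spec (exists_isTriDisc_of_coconnected _ S rfl hne hconn hco)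
  { verts := S
    base := Classical.choose (exists_isTriDisc_of_coconnected _ S rfl hne hconn hco)
    pos := Fin.elim0
    base_mem := hD.base_mem
    connected := connected_induce_of_pathIn ⟨hne.choose, mem_coe.2 hne.choose_spec⟩ hconn
    outer_connected := hD.outer_connected
    no_cut := fun v hv => preconnected_induce_of_pathIn fun x hx y hy => hnc v hv x (mem_coe.1 hx) y (mem_coe.1 hy)
    outer_no_cut := fun v hv => preconnected_induce_of_pathIn fun x hx y hy => honc v hv x (mem_coe.1 hx) y (mem_coe.1 hy)
    euler := hD.euler
    cycle := hD.cycle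
    cycle_len := hD.cycle_len
    pos_zero := fun h => absurd h (lt_irrefl 0)
    pos_strictMono := fun i => Fin.elim0 i
    pos_lt := fun i => Fin.elim0 i
    mark_pred := fun i => Fin.elim0 i
    mark_pred_pred := fun i => Fin.elim0 i
    mark_injective := fun i => Fin.elim0 i }

/-- The site set of `ofPolyhex`. [folklore] -/
@[simp] theorem TriMarkedDomain.ofPolyhex_verts (S : Finset (Site 2)) (hne : S.Nonempty) (hconn) (hco) (hnc) (honc) :
    (TriMarkedDomain.ofPolyhex S hne hconn hco hnc honc).verts = S := rfl

namespace TriMarkedDomain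

variable {j : ℕ} (D : TriMarkedDomain j)

/-- **Marking a discrete domain**: given positions `q 0 < q 1 < ⋯ < q (k-1) < q 0 + #∂` along
the boundary cycle of a discrete domain (read from its base), each pointing to the second
outside neighbour of its tail (the dart before has the same tail, the one before that a
different one) and with distinct tails, the same domain marked at these darts and rebased at
the first (Bollobás–Riordan 2006, Ch. 7 §7.2.2 p. 169: marked sites "appearing in this order as
`∂⁻(G)` is traversed anticlockwise", each "adjacent to at least two sites of `T ∖ G`"). [cite: BollobasRiordan2006, Ch. 7 §7.2.2 p. 169] -/
def withMarks {k : ℕ} (hk : 0 < k) (q : Fin k → ℕ) (hq : StrictMono q)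
    (hqlt : ∀ i, q i < q ⟨0, hk⟩ + #(triBdryDarts D.verts))
    (hpred : ∀ i, (triBdryIter D.verts D.base (q i + (#(triBdryDarts D.verts) - 1))).1 =
      (triBdryIter D.verts D.base (q i)).1)
    (hpred2 : ∀ i, (triBdryIter D.verts D.base (q i + (#(triBdryDarts D.verts) - 2))).1 ≠
      (triBdryIter D.verts D.base (q i)).1)
    (hinj : Function.Injective fun i => (triBdryIter D.verts D.base (q i)).1) : TriMarkedDomain k :=
  have hR : IsTriDisc D.verts (triBdryIter D.verts D.base (q ⟨0, hk⟩)) :=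
    D.isTriDisc.rebase (triBdryIter_mem D.base_mem _)
  have hle : ∀ i, q ⟨0, hk⟩ ≤ q i := fun i => hq.monotone (Fin.mk_le_mk.2 (Nat.zero_le _))
  { verts := D.verts
    base := triBdryIter D.verts D.base (q ⟨0, hk⟩)
    pos := fun i => q i - q ⟨0, hk⟩
    base_mem := triBdryIter_mem D.base_mem _
    connected := D.connected
    outer_connected := D.outer_connected
    no_cut := D.no_cut
    outer_no_cut := D.outer_no_cut
    euler := D.euler
    cycle := hR.cycle
    cycle_len := hR.cycle_len
    pos_zero := fun _ => Nat.sub_self _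
    pos_strictMono := fun a b hab => by
      have := hq hab; have := hle a; simp only; omega
    pos_lt := fun i => by have := hqlt i; have := hle i; omega
    mark_pred := fun i => by
      rw [← triBdryIter_add, ← triBdryIter_add, show q ⟨0, hk⟩ + (q i - q ⟨0, hk⟩ + _) = q i + (#(triBdryDarts D.verts) - 1) by
        have := hle i; omega, show q ⟨0, hk⟩ + (q i - q ⟨0, hk⟩) = q i by have := hle i; omega]
      exact hpred i
    mark_pred_pred := fun i => by
      rw [← triBdryIter_add, ← triBdryIter_add, show q ⟨0, hk⟩ + (q i - q ⟨0, hk⟩ + _) = q i + (#(triBdryDarts D.verts) - 2) by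
        have := hle i; omega, show q ⟨0, hk⟩ + (q i - q ⟨0, hk⟩) = q i by have := hle i; omega]
      exact hpred2 i
    mark_injective := fun a b hab => by
      apply hinj
      simp only at hab ⊢
      rwa [← triBdryIter_add, ← triBdryIter_add, show q ⟨0, hk⟩ + (q a - q ⟨0, hk⟩) = q a by have := hle a; omega,
        show q ⟨0, hk⟩ + (q b - q ⟨0, hk⟩) = q b by have := hle b; omega] at hab }

/-- The site set of `withMarks`. [folklore] -/
@[simp] theorem withMarks_verts {k : ℕ} (hk : 0 < k) (q : Fin k → ℕ) (hq) (hqlt) (hpred) (hpred2) (hinj) :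
    (D.withMarks hk q hq hqlt hpred hpred2 hinj).verts = D.verts := rfl

/-- The marked darts of `withMarks` are the darts at the given positions. [folklore] -/
theorem withMarks_markDart {k : ℕ} (hk : 0 < k) (q : Fin k → ℕ) (hq) (hqlt) (hpred) (hpred2) (hinj) (i : Fin k) :
    (D.withMarks hk q hq hqlt hpred hpred2 hinj).markDart i = triBdryIter D.verts D.base (q i) := by
  have hle : q ⟨0, hk⟩ ≤ q i := hq.monotone (Fin.mk_le_mk.2 (Nat.zero_le _))
  show triBdryIter D.verts (triBdryIter D.verts D.base (q ⟨0, hk⟩)) (q i - q ⟨0, hk⟩) = _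
  rw [← triBdryIter_add, show q ⟨0, hk⟩ + (q i - q ⟨0, hk⟩) = q i by omega]

end TriMarkedDomain

end Literature.Probability.Percolation
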